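import Summits.RiemannHypothesis.RiemannHypothesis.Theorems.WeilFormatCDataO103MFrontData
import Summits.RiemannHypothesis.RiemannHypothesis.Theorems.S2FormatCE0
import Literature.NumberTheory.LFunctions.YoshidaWindowGramTailMSSines
import Literature.NumberTheory.LFunctions.YoshidaWindowGramMiddleJBox
import Literature.NumberTheory.LFunctions.YoshidaWindowGramTailJFactoredScaled
import Literature.NumberTheory.LFunctions.YoshidaWindowGramTailMSFactored
import Literature.NumberTheory.LFunctions.YoshidaWindowGramTailJDiagTight
import Summits.RiemannHypothesis.RiemannHypothesis.Theorems.FormatCPsdBands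
import Summits.RiemannHypothesis.RiemannHypothesis.Theorems.WeilFormatCDiagShift
import Summits.RiemannHypothesis.RiemannHypothesis.Theorems.FormatCPsdSymmBands
import HarnessLib

/-!
# Format C kernel rung `O103M` (a = 103/100, column-band layout): odd sector (P): dyadic-Cholesky row budgets, rows 48…63 (kernel certificates)

Window `a = 103/100`; prime powers in the window: 2, 3, 2^2, 5, 7; prime constant A = 2148/1000 (`WeilFormatC.primeCoeff_form_ge_cells_v2`); evaluator parameters S = 2^320, Kpi 160, Kser 190, kred 8, Kexp 55, J 150; full table modes < 257; light column table modes < 2051; units 2^-310 (Schur entries), 2^-154 (column digits, width 157), 2^-148 (tail-factor digits, width 151), 2^-64 (reciprocal weights), 2^-40 (tail base); order-J tail J = 4, θ = 1/2048, η = 1/10 | 4/1.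
Design row: sr-gb-rung-b B g21 hp odd λ-run (parity cell 14 L-side): a = 103/100, A = 2148/1000 (cells_v2), μ = 2^-95, odd 256/512/2048, kit precision S 2^320 / c 310 / Kpi 160 / Kser 190 / Kexp 55 / J 150 (A g23 hp levers), MS tail; see HOME(B)/CELL14-LSIDE-B-g21.md. Generated by sr-gb-rung-a prover A g22 with rh-explicit-weil-2 gen7's generator extended for the odd λ-run (--sector odd --mu-log2; HOME(A)/code-g22/gen7/gramgen7.py sha16 b21c14hp103m0001) from `#eval` of the tree's `Encl` functions; every datum is re-verified by the kernel in the theorem files (`decide +kernel`). Helper data of the rh-explicit Weil-positivity programme (format C, K-CELL-2), RH-free. [cite: Yoshida1992HermitianForms, §5 (5.15)-(5.16) p. 301; §7 pp. 305–312]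
-/

set_option linter.dupNamespace false
set_option exponentiation.threshold 1024
set_option maxRecDepth 200000

namespace Summit.RiemannHypothesis.RiemannHypothesis.Theorems.WeilFormatCData.O103MCBOdd

open Literature.NumberTheory.LFunctions Literature.NumberTheory.LFunctions.PsdDyadic Summit.RiemannHypothesis.RiemannHypothesis.Theorems.FormatCPsd

/-- kernel: (P) row budgets `[48, 56)` (radius = the Schur radius `rho`). -/
theorem tPB48 : checkPsdBand O103MCBOdd.δ O103MCBOdd.rho O103MCBOdd.DS' O103MCBOdd.L 48 8 = true := by decide +kernel

/-- kernel: (P) row budgets `[56, 64)` (radius = the Schur radius `rho`). -/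
theorem tPB56 : checkPsdBand O103MCBOdd.δ O103MCBOdd.rho O103MCBOdd.DS' O103MCBOdd.L 56 8 = true := by decide +kernel

/-- kernel: symmetry of `DS'` on rows `[48, 56)` against the lower triangle. -/
theorem tSy48 : (List.range' 48 8).all (fun i ↦ (List.range i).all fun j ↦ decide (getMZ O103MCBOdd.DS' i j = getMZ O103MCBOdd.DS' j i)) = true := by
  decide +kernel

/-- kernel: symmetry of `DS'` on rows `[56, 64)` against the lower triangle. -/
theorem tSy56 : (List.range' 56 8).all (fun i ↦ (List.range i).all fun j ↦ decide (getMZ O103MCBOdd.DS' i j = getMZ O103MCBOdd.DS' j i)) = true := by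
  decide +kernel

/-- kernel: `DS' = DS − lamZ·1` on rows `[48, 56)`. -/
theorem tSh48 : WeilFormatC.checkDiagShiftRows 256 O103MCBOdd.DS O103MCBOdd.DS' O103MCBOdd.lamZ 48 8 = true := by decide +kernel

/-- kernel: `DS' = DS − lamZ·1` on rows `[56, 64)`. -/
theorem tSh56 : WeilFormatC.checkDiagShiftRows 256 O103MCBOdd.DS O103MCBOdd.DS' O103MCBOdd.lamZ 56 8 = true := by decide +kernel

end Summit.RiemannHypothesis.RiemannHypothesis.Theorems.WeilFormatCData.O103MCBOdd
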